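import Literature.NumberTheory.GaloisRepresentations.GaloisCohomology
import Mathlib.Algebra.Module.ZMod
import Mathlib.GroupTheory.GroupAction.Quotient
import HarnessLib

/-!
# Klein four-group Galois modules: stabilisers, the coordinate functional, the orbit of order `3`
# (K4 `SignedControlAtTwo`, archimedean row at the consumed module `E[2]`, file 1/3)

Crux K4 `SignedControlAtTwo` (stmt-BirchSwinnertonDyer-20309; routes `ThetaPartnerAtTwo` / `ResidualThetaTransportAtTwo`),
line `eulerchar` v12; width seat `bsd-wall-tp2-p3-w3` g8 (`--supports stmt-BirchSwinnertonDyer-20309`, helper).  The registered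
stub `stub_poitouTateThreeRealRat : poitouTate_three_realPlaces_injective ℚ` (Milne *ADT* I Thm. 4.10 (c), `r = 3`) is consumed by
the line ONLY at the module `E[2]` (`SignedEC.ShaTwo.exists_nsmul_eq_of_mem_shaTwo`, the obstruction to halving a class of
`Ш²(ℚ, E[2^M])` lies in `H³(ℚ, E[2])`).  On the sub-row where complex conjugation MOVES `E[2]` (⟺ `Δ(E) < 0`) that instance is a
THEOREM — `H³(ℚ, E[2]) = 0` — by the following group-cohomological mechanism, whose elementary module-theoretic half is this file:

Let a topological group `G` act continuously (`ContinuousRep G ℤ M`) on a discrete abelian group `M` which is a Klein four-group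
`V = {0, P₁, P₂, P₁ + P₂}` (`IsKleinFour M P₁ P₂`: every element is one of the four, `2M = 0`, `P₁, P₂` distinct and non-zero —
a hypothesis bundle, a `structure` with body, not a named fact).

* §1 `stabilizerSubgroup ρ P` (`Stab_G(P)`, open for discrete `M`), `isOpen_ker_of_finite`, `mem_ker_iff_forall`,
  `ker_le_stabilizerSubgroup`;
* §2 `IsKleinFour`, the coordinate functional `lam : M →+ ℤ/2` (`P₁, P₁ + P₂ ↦ 1`, `0, P₂ ↦ 0`);
* §3 the DICHOTOMY on `S = Stab(P₁ + P₂)` (`apply_eq_or_of_mem_stabilizer`: an element of `S` fixes or swaps `P₁, P₂`;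
  fixing both means acting trivially, `mem_ker_of_apply_eq`), and **`index_stabilizerSubgroup_eq_three`**: if no non-zero
  vector is `G`-fixed and some `τ ∈ G` swaps `P₁, P₂`, the orbit of `P₁ + P₂` is the set of the three non-zero vectors, so
  `(G : S) = 3` (Mathlib `MulAction.index_stabilizer`).

Sequel (`…KleinFourVanishing.lean`): `V|_S ≅ M_S^N(𝔽₂)` is coinduced from the kernel `N`, so by Shapiro `H^q(S, V) = H^q(N, 𝔽₂)`,
which vanishes above `cd₂(N)`; with `(G : S) = 3` odd and `2V = 0`, `H³(G, V) = 0`.  HONEST FRAMING: THEOREMS and auxiliary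
definitions with bodies only (no named fact, no instance, no `sorry`); generic in `G`, nothing about any curve is asserted;
closes no item; BSD is not proved by any of this.

References: [SerreGaloisCohomology1997] I §2.1, §2.4 Prop. 9, §2.5 Prop. 10; [MilneADT2006] I Thm. 4.10 (c).
-/

set_option autoImplicit false
-- the Theorems namespace of this sub repeats the summit name by design (D-0017 nested layout)
set_option linter.dupNamespace false

noncomputable section

namespace Summit.BirchSwinnertonDyer.BirchSwinnertonDyer.Theorems.SignedEC.KleinFour

open Literature.NumberTheory.GaloisRepresentations

/-! ## §1 Stabilisers and the kernel of a continuous action on a discrete module -/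

section Stabilizer

variable {G : Type*} [Group G] [TopologicalSpace G] {A : Type*} [CommRing A] [TopologicalSpace A]
  {M : Type*} [AddCommGroup M] [Module A M] [TopologicalSpace M]

/-- The stabiliser `Stab_G(P) = {g | g P = P}` of a vector, a subgroup of `G`. [folklore] -/
def stabilizerSubgroup (ρ : ContinuousRep G A M) (P : M) : Subgroup G where
  carrier := {g | ρ g P = P}
  mul_mem' {g h} hg hh := by
    change ρ (g * h) P = P
    rw [map_mul, Module.End.mul_apply, hh, hg]
  one_mem' := by
    change ρ 1 P = P
    rw [map_one, Module.End.one_apply]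
  inv_mem' {g} hg := by
    change ρ g⁻¹ P = P
    conv_lhs => rw [← hg]
    rw [← Module.End.mul_apply, ← map_mul, inv_mul_cancel, map_one, Module.End.one_apply]

/-- Membership in the stabiliser. [folklore] -/
@[simp] theorem mem_stabilizerSubgroup (ρ : ContinuousRep G A M) (P : M) (g : G) :
    g ∈ stabilizerSubgroup ρ P ↔ ρ g P = P := Iff.rfl

/-- The kernel is contained in every stabiliser. [folklore] -/
theorem ker_le_stabilizerSubgroup (ρ : ContinuousRep G A M) (P : M) : ρ.ker ≤ stabilizerSubgroup ρ P :=
  fun g hg => by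
    rw [mem_stabilizerSubgroup, (ρ.mem_ker g).1 hg, LinearMap.id_apply]

/-- Membership in the kernel, pointwise. [folklore] -/
theorem mem_ker_iff_forall (ρ : ContinuousRep G A M) (g : G) : g ∈ ρ.ker ↔ ∀ m, ρ g m = m := by
  rw [ContinuousRep.mem_ker, LinearMap.ext_iff]
  rfl

variable [DiscreteTopology M]

/-- Stabilisers of a continuous action on a DISCRETE module are open (Serre I §2.1).
[cite: SerreGaloisCohomology1997, I §2.1] -/
theorem isOpen_stabilizerSubgroup (ρ : ContinuousRep G A M) (P : M) :
    IsOpen (stabilizerSubgroup ρ P : Set G) :=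
  ρ.isOpen_setOf_apply_eq P

/-- The kernel of a continuous action on a FINITE discrete module is open (a finite intersection of
stabilisers). [cite: SerreGaloisCohomology1997, I §2.1] -/
theorem isOpen_ker_of_finite [Finite M] (ρ : ContinuousRep G A M) : IsOpen (ρ.ker : Set G) := by
  have : (ρ.ker : Set G) = ⋂ m : M, {g | ρ g m = m} := by
    ext g
    simp only [SetLike.mem_coe, mem_ker_iff_forall, Set.mem_iInter, Set.mem_setOf_eq]
  rw [this]
  exact isOpen_iInter_of_finite fun m => ρ.isOpen_setOf_apply_eq m

end Stabilizer

/-! ## §2 The Klein four-group module: the functional `λ` and the permutation structure -/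

section Lam

variable {G : Type} [Group G] [TopologicalSpace G] [IsTopologicalGroup G]
variable {M : Type} [AddCommGroup M] [TopologicalSpace M] [DiscreteTopology M]
variable (ρ : ContinuousRep G ℤ M) {P₁ P₂ : M}

/-- Hypotheses «`M` is the Klein four-group `{0, P₁, P₂, P₁ + P₂}`»: every element is one of the four,
`2M = 0`, and `P₁`, `P₂` are distinct and non-zero. [folklore] -/
structure IsKleinFour (M : Type) [AddCommGroup M] (P₁ P₂ : M) : Prop where
  -- hypothesis bundle (a structure with body), not a named fact
  /-- every element is `0`, `P₁`, `P₂` or `P₁ + P₂` -/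
  eq_or : ∀ m : M, m = 0 ∨ m = P₁ ∨ m = P₂ ∨ m = P₁ + P₂
  /-- `2M = 0` -/
  two_nsmul : ∀ m : M, 2 • m = 0
  /-- `P₁ ≠ 0` -/
  ne_zero₁ : P₁ ≠ 0
  /-- `P₂ ≠ 0` -/
  ne_zero₂ : P₂ ≠ 0
  /-- `P₁ ≠ P₂` -/
  ne₁₂ : P₁ ≠ P₂

namespace IsKleinFour

variable {M : Type} [AddCommGroup M] {P₁ P₂ : M} (h : IsKleinFour M P₁ P₂)
include h

/-- `m + m = 0`. [folklore] -/
theorem add_self (m : M) : m + m = 0 := by rw [← _root_.two_nsmul]; exact h.two_nsmul m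

/-- `-m = m`. [folklore] -/
theorem neg_eq (m : M) : -m = m := by
  rw [neg_eq_iff_add_eq_zero, h.add_self]

/-- `P₁ + P₂ ≠ 0`. [folklore] -/
theorem add_ne_zero : P₁ + P₂ ≠ 0 := fun h0 =>
  h.ne₁₂ (by rw [add_eq_zero_iff_eq_neg, h.neg_eq] at h0; exact h0)

/-- `P₁ + P₂ ≠ P₁`. [folklore] -/
theorem add_ne_left : P₁ + P₂ ≠ P₁ := fun h0 => h.ne_zero₂ (by simpa using h0)

/-- `P₁ + P₂ ≠ P₂`. [folklore] -/
theorem add_ne_right : P₁ + P₂ ≠ P₂ := fun h0 => h.ne_zero₁ (by simpa using h0)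

end IsKleinFour

/-- The functional `λ : M → ℤ/2` with `λ(P₁) = λ(P₁ + P₂) = 1`, `λ(0) = λ(P₂) = 0` (the coordinate along
`P₁` in the basis `(P₁, P₂)`). [folklore] -/
def lamFun (P₁ P₂ : M) (m : M) : ZMod 2 :=
  by classical exact if m = P₁ ∨ m = P₁ + P₂ then 1 else 0

omit [TopologicalSpace M] [DiscreteTopology M] in
/-- Values of `λ`. [folklore] -/
theorem lamFun_values (h : IsKleinFour M P₁ P₂) :
    lamFun P₁ P₂ 0 = 0 ∧ lamFun P₁ P₂ P₁ = 1 ∧ lamFun P₁ P₂ P₂ = 0 ∧ lamFun P₁ P₂ (P₁ + P₂) = 1 := by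
  classical
  refine ⟨?_, ?_, ?_, ?_⟩
  · simp only [lamFun, h.ne_zero₁.symm, h.add_ne_zero.symm, or_self, if_false]
  · simp only [lamFun, true_or, if_true]
  · simp only [lamFun, h.ne₁₂.symm, h.add_ne_right.symm, or_self, if_false]
  · simp only [lamFun, or_true, if_true]

omit [TopologicalSpace M] [DiscreteTopology M] in
/-- `λ` is additive (case check on the sixteen sums of the Klein four-group). [folklore] -/
theorem lamFun_add (h : IsKleinFour M P₁ P₂) (m m' : M) :
    lamFun P₁ P₂ (m + m') = lamFun P₁ P₂ m + lamFun P₁ P₂ m' := by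
  obtain ⟨h0, h1, h2, h3⟩ := lamFun_values h
  have h11 : (1 : ZMod 2) + 1 = 0 := by decide
  have e11 : P₁ + P₁ = 0 := h.add_self P₁
  have e22 : P₂ + P₂ = 0 := h.add_self P₂
  have e33 : (P₁ + P₂) + (P₁ + P₂) = 0 := h.add_self _
  have e13 : P₁ + (P₁ + P₂) = P₂ := by rw [← add_assoc, e11, zero_add]
  have e31 : (P₁ + P₂) + P₁ = P₂ := by rw [add_comm, e13]
  have e23 : P₂ + (P₁ + P₂) = P₁ := by rw [add_comm P₁ P₂, ← add_assoc, e22, zero_add]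
  have e32 : (P₁ + P₂) + P₂ = P₁ := by rw [add_comm, e23]
  have e21 : P₂ + P₁ = P₁ + P₂ := add_comm _ _
  rcases h.eq_or m with rfl | rfl | rfl | rfl <;> rcases h.eq_or m' with rfl | rfl | rfl | rfl <;>
    simp only [zero_add, add_zero, e11, e22, e33, e13, e31, e23, e32, e21, h0, h1, h2, h3, h11]

/-- `λ` as an additive monoid homomorphism. [folklore] -/
def lam (h : IsKleinFour M P₁ P₂) : M →+ ZMod 2 where
  toFun := lamFun P₁ P₂
  map_zero' := (lamFun_values h).1
  map_add' := lamFun_add h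

omit [TopologicalSpace M] [DiscreteTopology M] in
/-- Unfolding `lam`. [folklore] -/
@[simp] theorem lam_apply (h : IsKleinFour M P₁ P₂) (m : M) : lam h m = lamFun P₁ P₂ m := rfl

end Lam

/-! ## §3 Orbit and stabiliser: `(G : Stab(P₁ + P₂)) = 3`; the dichotomy on `Stab(P₁ + P₂)` -/

section Orbit

variable {G : Type} [Group G] [TopologicalSpace G]
variable {M : Type} [AddCommGroup M] [TopologicalSpace M]
variable (ρ : ContinuousRep G ℤ M) {P₁ P₂ : M}

/-- `ρ g m = 0 ⟹ m = 0` (`ρ g` is invertible). [folklore] -/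
theorem eq_zero_of_apply_eq_zero {g : G} {m : M} (hm : ρ g m = 0) : m = 0 := by
  have := congrArg (ρ g⁻¹) hm
  rwa [map_zero, ← Module.End.mul_apply, ← map_mul, inv_mul_cancel, map_one,
    Module.End.one_apply] at this

/-- **Dichotomy on the stabiliser of `P₁ + P₂`**: an element fixing `P₁ + P₂` either fixes `P₁` and `P₂`
or swaps them. [folklore] -/
theorem apply_eq_or_of_mem_stabilizer (h : IsKleinFour M P₁ P₂) {g : G}
    (hg : g ∈ stabilizerSubgroup ρ (P₁ + P₂)) :
    (ρ g P₁ = P₁ ∧ ρ g P₂ = P₂) ∨ (ρ g P₁ = P₂ ∧ ρ g P₂ = P₁) := by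
  rw [mem_stabilizerSubgroup] at hg
  have e2 : P₂ = (P₁ + P₂) + P₁ := by rw [add_comm P₁ P₂, add_assoc, h.add_self, add_zero]
  have hP₂ : ρ g P₂ = (P₁ + P₂) + ρ g P₁ := by
    conv_lhs => rw [e2]
    rw [map_add, hg]
  rcases h.eq_or (ρ g P₁) with h' | h' | h' | h'
  · exact absurd (eq_zero_of_apply_eq_zero ρ h') h.ne_zero₁
  · refine Or.inl ⟨h', ?_⟩
    rw [hP₂, h', ← e2]
  · refine Or.inr ⟨h', ?_⟩
    rw [hP₂, h', add_assoc, h.add_self, add_zero]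
  · exfalso
    apply h.ne_zero₂
    apply eq_zero_of_apply_eq_zero ρ (g := g)
    rw [hP₂, h', h.add_self]

/-- An element fixing `P₁` and `P₂` acts trivially. [folklore] -/
theorem mem_ker_of_apply_eq (h : IsKleinFour M P₁ P₂) {g : G} (h₁ : ρ g P₁ = P₁) (h₂ : ρ g P₂ = P₂) :
    g ∈ ρ.ker := by
  rw [mem_ker_iff_forall]
  intro m
  rcases h.eq_or m with rfl | rfl | rfl | rfl
  · exact map_zero _
  · exact h₁
  · exact h₂
  · rw [map_add, h₁, h₂]

/-- A transposition `τ` (`τ P₁ = P₂`, `τ P₂ = P₁`) fixes `P₁ + P₂`. [folklore] -/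
theorem mem_stabilizer_of_swap {τ : G} (hτ₁ : ρ τ P₁ = P₂) (hτ₂ : ρ τ P₂ = P₁) :
    τ ∈ stabilizerSubgroup ρ (P₁ + P₂) := by
  rw [mem_stabilizerSubgroup, map_add, hτ₁, hτ₂, add_comm]

/-- **`(G : Stab_G(P₁ + P₂)) = 3`** when no non-zero vector is `G`-fixed and some `τ ∈ G` swaps `P₁`, `P₂`
(the orbit of `P₁ + P₂` is the set of the three non-zero vectors). [folklore] -/
theorem index_stabilizerSubgroup_eq_three (h : IsKleinFour M P₁ P₂)
    (h0 : ∀ m : M, m ≠ 0 → ∃ g : G, ρ g m ≠ m) {τ : G} (hτ₁ : ρ τ P₁ = P₂) (hτ₂ : ρ τ P₂ = P₁) :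
    (stabilizerSubgroup ρ (P₁ + P₂)).index = 3 := by
  letI : MulAction G M := MulAction.compHom M (ρ.toRepresentation : G →* Module.End ℤ M)
  have hsmul : ∀ (g : G) (m : M), g • m = ρ g m := fun _ _ => rfl
  have hstab : MulAction.stabilizer G (P₁ + P₂) = stabilizerSubgroup ρ (P₁ + P₂) := by
    ext g
    rw [MulAction.mem_stabilizer_iff, hsmul, mem_stabilizerSubgroup]
  rw [← hstab, MulAction.index_stabilizer, Set.ncard_eq_three]
  refine ⟨P₁ + P₂, P₁, P₂, h.add_ne_left, h.add_ne_right, h.ne₁₂, ?_⟩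
  have hne : ∀ g : G, ρ g (P₁ + P₂) ≠ 0 := fun g hg => h.add_ne_zero (eq_zero_of_apply_eq_zero ρ hg)
  ext m
  simp only [Set.mem_insert_iff, Set.mem_singleton_iff, MulAction.mem_orbit_iff, hsmul]
  constructor
  · rintro ⟨g, rfl⟩
    rcases h.eq_or (ρ g (P₁ + P₂)) with h' | h' | h' | h'
    · exact absurd h' (hne g)
    · exact Or.inr (Or.inl h')
    · exact Or.inr (Or.inr h')
    · exact Or.inl h'
  · obtain ⟨g, hg⟩ := h0 (P₁ + P₂) h.add_ne_zero
    have hgP : ρ g (P₁ + P₂) = P₁ ∨ ρ g (P₁ + P₂) = P₂ := by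
      rcases h.eq_or (ρ g (P₁ + P₂)) with h' | h' | h' | h'
      · exact absurd h' (hne g)
      · exact Or.inl h'
      · exact Or.inr h'
      · exact absurd h' hg
    rintro (rfl | rfl | rfl)
    · exact ⟨1, by rw [map_one, Module.End.one_apply]⟩
    · rcases hgP with h' | h'
      · exact ⟨g, h'⟩
      · exact ⟨τ * g, by rw [map_mul, Module.End.mul_apply, h', hτ₂]⟩
    · rcases hgP with h' | h'
      · exact ⟨τ * g, by rw [map_mul, Module.End.mul_apply, h', hτ₁]⟩
      · exact ⟨g, h'⟩

end Orbit

end Summit.BirchSwinnertonDyer.BirchSwinnertonDyer.Theorems.SignedEC.KleinFour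

end
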